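import Summits.HodgeConjecture.HodgeConjecture.Theorems.F0P6aLineSpecialisationLetters
import HarnessLib

/-!
# `F0P6aLineSpecialisationLayer` — ★ RE-HOME of `Lines/F0_P6a_LineSpecialisation.lean` (tree ED. 3 sha16 d6354130763e131e), PART 2 of 6 — tree lines :297–:644.

See PART 1 `Theorems/F0P6aLineSpecialisationLetters.lean` for the full ★ re-home header and the original module docstring (verbatim there).  Same namespace (every fully-qualified name unchanged);
the scopes open at the cut (`noncomputable section` ∕ `namespace` ∕ `section`s) are re-opened below with their `variable` ∕ `open` ∕ `set_option` ∕ `omit` ∕ `include` ∕ `universe` lines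
replayed verbatim from the tree, in order; the code after the replay block is the tree bytes :297–:644, untouched.  HC_CM is proved only modulo the 7 printed citations (2 remaining: hLiu418 = stmt-HodgeConjecture-24832, h413 = stmt-HodgeConjecture-24833) until rung 0 closes; a re-home is count-neutral.
-/

-- ── replay of the scopes open at tree line :297 (verbatim) ──
set_option autoImplicit false
set_option linter.dupNamespace false
noncomputable section
namespace Summit.HodgeConjecture.HodgeConjecture.Cruxes.HLiu418.F0P6aLineSpecialisation
open CategoryTheory CategoryTheory.Limits NumberField IsDedekindDomain MulAction AlgebraicGeometry
open scoped Matrix Polynomial Pointwise MonoidalCategory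
open Literature.NumberTheory.GaloisRepresentations
open Literature.NumberTheory.Automorphic Literature.NumberTheory.Automorphic.UnitaryGroup
open Literature.AlgebraicGeometry.ShimuraVarieties.UnitaryCanonicalModel
open Literature.NumberTheory.Automorphic.Liu2021.AppendixC
open Literature.AlgebraicGeometry.Motives (AlgPoints IntegralModel SchemeOver thickening thickeningGalAction thickeningLift specOver extendPoint
  specValuationSubring specFractionFieldι specRingHomι)
open Literature.NumberTheory.DiophantineGeometry (geomResidueField specialFibreFunctor specResidueField geomClosedPointIsoSpecResidueField
  geomResidueFieldEquiv toClosureValuationSubring)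
open Literature.AlgebraicGeometry.RelativeSpec (ActionOver)
open Literature.NumberTheory.EllipticCurves (genericFibre specGenericPoint)
open Literature.AlgebraicGeometry.AbelianSchemes Literature.AlgebraicGeometry.AbelianSchemes.AbelianSchemeOver
open Literature.AlgebraicGeometry.GroupSchemes.AffineGroupScheme (Alg)
open Summit.HodgeConjecture.HodgeConjecture.Cruxes.HLiu418.F0P6aModuliDatumDefs
open Summit.HodgeConjecture.HodgeConjecture.Cruxes.HLiu418.F0P6aRGDAssembly
open Summit.HodgeConjecture.HodgeConjecture.Cruxes.HLiu418.F0P6aDatumOfInputs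
-- ── tree bytes :297–:644 ──

/-! ### §2 The line count -/

section LineCount

-- the frame of the D-line՚s `Letters` section VERBATIM
variable {F : Type} [Field F] [NumberField F] [IsCMField F] {ι₁ : F →+* ℂ}
    {Jstar : Matrix (Fin 2) (Fin 2) F}
    {K₀ : C5.OpenCompactSubgroup ↥(finAdelic ↥(maximalRealSubfield F) F (IsCMField.complexConj F) 2 Jstar)}
    {S : RecordSystemGS F Jstar ι₁ K₀} {hU7ₛ : S.HeckeTranslateDefinedOver}
    {hJ : (Jstar.map (IsCMField.complexConj F))ᵀ = Jstar} {hJu : IsUnit Jstar}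
    {Fi : Type} [Field Fi] [Algebra F Fi] {Kc : C5.SmallLevel K₀} {G : Type} [Group G]
    {𝓜 : IntegralModel (𝓞 F) F ((thickening F Fi).obj (S.M.obj Kc))}
    {w : HeightOneSpectrum (𝓞 F)} {hw : (IsCMField.complexConj F) • w ≠ w} {h𝓨 : (𝓜.localise w).IsSmoothProper 1}
    {θ : ActionOver (𝓜.localise w).total.hom ((Fi ≃ₐ[F] Fi) × G)}
    {e : Fi →ₐ[F] AlgebraicClosure (w.adicCompletion F)}

open scoped MonObj CategoryTheory.Obj in
set_option backward.isDefEq.respectTransparency false in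
/-- **THE ★ (L-q-sub) COUNT AS A FUNCTION OF THE FIELD** (`K` generic, so that its instances are elaborated exactly as in ★ (L-q-sub) §3 — `Field.toCommRing` paths):
the number of `ι`-stable subgroups of order `r` of `A_K(K)` made of `𝔭`-torsion points.  A counting abbreviation, NOT a new notion. [cite: Tate1997FiniteFlatGroupSchemes, (3.7)] -/
def KCount {R : Type} [CommRing R] (K : Type) [Field K] [Algebra R K] (A : AbelianSchemeOver (Spec (.of R))) {O : Type} [CommRing O]
    (act : A.RingAction O) (𝔭 : Ideal O) (r : ℕ) : ℕ :=
  Nat.card {H : Subgroup (AlgPoints (A.baseChange (Spec.map (CommRingCat.ofHom (algebraMap R K)))).X K) //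
    Nat.card H = r ∧ (∀ t ∈ H, ∀ a ∈ 𝔭, t ≫ (act.baseChange (Spec.map (CommRingCat.ofHom (algebraMap R K)))).i a = 1) ∧
      ∀ a, ∀ t ∈ H, t ≫ (act.baseChange (Spec.map (CommRingCat.ofHom (algebraMap R K)))).i a ∈ H}

omit [IsCMField F] in
set_option maxHeartbeats 400000 in
open scoped MonObj CategoryTheory.Obj in
set_option backward.isDefEq.respectTransparency false in
/-- **INSTANCE CAST, `Ω̄` concrete vs `K` generic**: the same count elaborated over the concrete `Ω̄ = AlgebraicClosure (F_w)` (Mathlib's direct `CommRing` instance on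
`AlgebraicClosure`) equals `KCount Ω̄` (the `Field.toCommRing` path of a generic field) — `rfl`, isolated in its own declaration because the definitional unfolding of the
two `CommRing` structures on `AlgebraicClosure` is expensive. [cite: Tate1997FiniteFlatGroupSchemes, (3.7)] -/
theorem natCard_eq_kCount (A : AbelianSchemeOver (Spec (.of ↥(closureValuationSubring (w.adicCompletion F))))) {O : Type} [CommRing O]
    (act : A.RingAction O) (𝔭 : Ideal O) (r : ℕ) :
    Nat.card {H : Subgroup (specOver (AlgebraicClosure (w.adicCompletion F)) (AlgebraicClosure (w.adicCompletion F)) ⟶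
        (A.baseChange (Spec.map (CommRingCat.ofHom (algebraMap ↥(closureValuationSubring (w.adicCompletion F))
          (AlgebraicClosure (w.adicCompletion F)))))).X) //
      Nat.card H = r ∧
      (∀ t ∈ H, ∀ a ∈ 𝔭, t ≫ (act.baseChange (Spec.map (CommRingCat.ofHom (algebraMap ↥(closureValuationSubring (w.adicCompletion F))
          (AlgebraicClosure (w.adicCompletion F)))))).i a = 1) ∧
      ∀ a, ∀ t ∈ H, t ≫ (act.baseChange (Spec.map (CommRingCat.ofHom (algebraMap ↥(closureValuationSubring (w.adicCompletion F))
          (AlgebraicClosure (w.adicCompletion F)))))).i a ∈ H} =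
    KCount (AlgebraicClosure (w.adicCompletion F)) A act 𝔭 r := rfl

set_option maxHeartbeats 400000 in
open scoped MonObj CategoryTheory.Obj in
set_option backward.isDefEq.respectTransparency false in
/-- **TRANSPORT OF `#LineOf` ALONG AN EQUIVARIANT ISOMORPHISM OF THE FIBRE** (★ (TR) `natCard_stableSubgroups_congr` on the points): for an abelian scheme `A′` over
`Spec R′`, a base-change morphism `g : Spec Ω̄ → Spec R′` and a group-scheme isomorphism `φ : A_y ≅ A′ ×_{R′} Ω̄` over `Ω̄` intertwining `ι(r)_y` with `ι(r)_{Ω̄}`,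
`#LineOf I y` is the number of `ι`-stable order-`q` subgroups of `(A′ ×_{R′} Ω̄)(Ω̄)` consisting of points killed by `ι(𝔭_{c•w})`.
[cite: Tate1997FiniteFlatGroupSchemes, (3.7)] [cite: BourbakiAlgebraI1989, Ch. I §4 no. 2 Def. 2–3 and no. 3 Def. 4] -/
theorem natCard_lineOf_eq_of_iso (I : RGDInputsAt F ι₁ Jstar K₀ S hU7ₛ hJ hJu Fi Kc G 𝓜 w hw h𝓨 θ e) [ExpChar (geomResidueField w) I.pChar]
    (y : AlgPoints (S.M.obj Kc) (AlgebraicClosure (w.adicCompletion F)))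
    {R' : Type} [CommRing R'] (A' : AbelianSchemeOver (Spec (.of R'))) (act' : A'.RingAction (𝓞 F))
    (g : Spec (.of (AlgebraicClosure (w.adicCompletion F))) ⟶ Spec (.of R'))
    (φ : (schΩOf S Kc 𝓜 w e I.univ y).X ≅ (A'.baseChange g).X) [IsMonHom φ.hom]
    (hβ : ∀ r, φ.hom ≫ (act'.baseChange g).i r = (actΩOf S Kc 𝓜 w e I.univ I.act r y).hom.hom.hom ≫ φ.hom) :
    Nat.card (LineOf I y) =
      Nat.card {H : Subgroup (specOver (AlgebraicClosure (w.adicCompletion F)) (AlgebraicClosure (w.adicCompletion F)) ⟶ (A'.baseChange g).X) //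
        Nat.card H = I.pChar ^ I.fDeg ∧
        (∀ t ∈ H, ∀ a ∈ ((IsCMField.complexConj F) • w).asIdeal, t ≫ (act'.baseChange g).i a = 1) ∧
        ∀ a, ∀ t ∈ H, t ≫ (act'.baseChange g).i a ∈ H} := by
  let β : 𝓞 F → ((A'.baseChange g).X ⟶ (A'.baseChange g).X) := fun r => (act'.baseChange g).i r
  let eMul : (fibreΩOf S Kc 𝓜 w e I.univ y).Points (AlgebraicClosure (w.adicCompletion F)) ≃*
      (specOver (AlgebraicClosure (w.adicCompletion F)) (AlgebraicClosure (w.adicCompletion F)) ⟶ (A'.baseChange g).X) :=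
    { toFun := fun t => t ≫ φ.hom, invFun := fun t => t ≫ φ.inv,
      left_inv := fun t => by simp only [Category.assoc, Iso.hom_inv_id, Category.comp_id],
      right_inv := fun t => by simp only [Category.assoc, Iso.inv_hom_id, Category.comp_id],
      map_mul' := fun a b => MonObj.mul_comp a b φ.hom }
  haveI : Mono φ.hom := ⟨fun g h hgh => (Iso.cancel_iso_hom_right g h φ).mp hgh⟩
  exact Literature.GroupTheory.StableSubgroups.natCard_stableSubgroups_congr eMul
    (fun (a : 𝓞 F) (t : (fibreΩOf S Kc 𝓜 w e I.univ y).Points (AlgebraicClosure (w.adicCompletion F))) =>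
      (AlgPoints.map (actΩOf S Kc 𝓜 w e I.univ I.act a y).hom.hom.hom t :
        (fibreΩOf S Kc 𝓜 w e I.univ y).Points (AlgebraicClosure (w.adicCompletion F))))
    (fun a t => t ≫ β a)
    (fun a t => by
      show (t ≫ (actΩOf S Kc 𝓜 w e I.univ I.act a y).hom.hom.hom) ≫ φ.hom = (t ≫ φ.hom) ≫ β a
      rw [Category.assoc, Category.assoc, hβ a])
    (fun t => IsIdealTorsionΩ S Kc 𝓜 w e I.univ I.act y ((IsCMField.complexConj F) • w).asIdeal t)
    (fun t => ∀ a ∈ ((IsCMField.complexConj F) • w).asIdeal, t ≫ β a = 1)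
    (fun t => by
      show (∀ a ∈ ((IsCMField.complexConj F) • w).asIdeal, t ≫ (actΩOf S Kc 𝓜 w e I.univ I.act a y).hom.hom.hom = 1) ↔
        ∀ a ∈ ((IsCMField.complexConj F) • w).asIdeal, (t ≫ φ.hom) ≫ β a = 1
      refine forall₂_congr fun a _ => ?_
      rw [Category.assoc, hβ a, ← Category.assoc]
      constructor
      · intro h; rw [h, MonObj.one_comp]
      · intro h; rw [← cancel_mono φ.hom, h, MonObj.one_comp])
    (I.pChar ^ I.fDeg)

set_option maxHeartbeats 400000 in
set_option synthInstance.maxHeartbeats 100000 in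
open scoped MonObj CategoryTheory.Obj in
set_option backward.isDefEq.respectTransparency false in
/-- **§2 HEAD — `#LineOf I y = q + 1`** (`q = p^f = #(𝒪_F ⧸ 𝔭_{c•w})`): the `𝒪_F`-stable subgroups of order `q` of `A_y[𝔭_{c•w}](Ω̄) ≅ 𝔽_q²` are its `q + 1` lines.
DOWN → UP: lift the tuple at `y` over the valuation ring `R ⊆ Ω̄` along `x̃ = extendPoint …` (valuative criterion), carry the dock `𝔡 (red₀ y)` (`G₀ ↪ A_{red₀ y}`, the
kernel-of-`𝔭` clause, rank `q²`) to the special fibre of the lift along the equivariant iso ★ `exists_iso_fibre_baseChange_of_comp_eq` (with `R → κ̄(w)` through `κ(R) ≅ κ̄(w)`),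
count the stable order-`q` subgroups of the `𝔭`-torsion `Ω̄`-points of the lift by ★ (L-q-sub) `natCard_stableSubgroups_baseChange_eq_succ_of_forall_iff`, and carry the count
to `LineOf I y` along the equivariant generic-fibre iso (★ (TR) `natCard_stableSubgroups_congr`).  L3's `hthree` ∕ L2's `htwo` read it through ★ `exists_ne_ne_of_natCard_eq_succ`.
[cite: Tate1997FiniteFlatGroupSchemes, (3.7)] [cite: Hirschfeld1998, §3.1 (Thm. 3.1.1)] [cite: SerreTate1968, §1 Lemma 2] -/
theorem natCard_lineOf_eq_succ (I : RGDInputsAt F ι₁ Jstar K₀ S hU7ₛ hJ hJu Fi Kc G 𝓜 w hw h𝓨 θ e) [ExpChar (geomResidueField w) I.pChar]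
    (𝔡 : ∀ xbar, DockAt I xbar) (y : AlgPoints (S.M.obj Kc) (AlgebraicClosure (w.adicCompletion F))) :
    Nat.card (LineOf I y) = I.pChar ^ I.fDeg + 1 := by
  -- the place, the prime, the residue count
  haveI : (((IsCMField.complexConj F) • w).asIdeal).IsMaximal := ((IsCMField.complexConj F) • w).isMaximal
  haveI : Finite (𝓞 F ⧸ ((IsCMField.complexConj F) • w).asIdeal) :=
    Nat.finite_of_card_ne_zero (by rw [I.hfDeg]; exact pow_ne_zero _ I.hpChar.1.ne_zero)
  haveI : IsProper (𝓜.localise w).total.hom := h𝓨.2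
  haveI : IsCommMonObj I.univ.X := I.comm
  -- the lift of the tuple over the valuation ring `R ⊆ Ω̄` of the point `ℓ_e y`
  let xt : Spec (.of ↥(closureValuationSubring (w.adicCompletion F))) ⟶ (𝓜.localise w).total.left :=
    (extendPoint (closureValuationSubring (w.adicCompletion F)) (toClosureValuationSubring w) (𝓜.localise w).total
      ((𝓜.localise w).modelPointsEquiv.symm (thickeningLift e (S.M.obj Kc) y))).left
  let 𝒜R : AbelianSchemeOver (Spec (.of ↥(closureValuationSubring (w.adicCompletion F)))) := I.univ.baseChange xt
  haveI : IsCommMonObj 𝒜R.X := inferInstanceAs (IsCommMonObj ((Over.pullback xt).obj I.univ.X))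
  let actR : 𝒜R.RingAction (𝓞 F) := I.act.baseChange xt
  -- a Serre presentation of `𝔭 = 𝔭_{c•w}`
  have hpres := Literature.NumberTheory.NumberFields.SerrePresentation.exists_serrePresentation_of_ideal
      (((IsCMField.complexConj F) • w).asIdeal) ((IsCMField.complexConj F) • w).ne_bot
  obtain ⟨m, E', hE', P, Q, N, hN0, hP, hQ, hQP, hPQ, hspan, -, -⟩ := hpres
  have hNΩ : ((N : ℕ) : AlgebraicClosure (w.adicCompletion F)) ≠ 0 := Nat.cast_ne_zero.mpr hN0
  -- the residue algebra `R → κ(R) ≅ κ̄(w)` and the closed point in `Spec.map (algebraMap R κ̄)` form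
  letI algκ : Algebra ↥(closureValuationSubring (w.adicCompletion F)) (geomResidueField w) :=
    (((geomResidueFieldEquiv w).symm : IsLocalRing.ResidueField ↥(closureValuationSubring (w.adicCompletion F)) →+* geomResidueField w).comp
      (IsLocalRing.residue ↥(closureValuationSubring (w.adicCompletion F)))).toAlgebra
  have hgκ : (geomClosedPointIsoSpecResidueField w).inv.left ≫
      (specRingHomι (closureValuationSubring (w.adicCompletion F)) (toClosureValuationSubring w)
        (IsLocalRing.residue ↥(closureValuationSubring (w.adicCompletion F)))).left =
      Spec.map (CommRingCat.ofHom (algebraMap ↥(closureValuationSubring (w.adicCompletion F)) (geomResidueField w))) := by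
    rw [RingHom.algebraMap_toAlgebra, CommRingCat.ofHom_comp, Spec.map_comp]
    rfl
  -- SPECIAL SIDE: the dock at `red₀ y` moves to the special fibre of the lift
  have hsqS : (red₀Of S Kc 𝓜 w h𝓨 e y).left ≫ pullback.fst (𝓜.localise w).total.hom (specResidueField w) =
      Spec.map (CommRingCat.ofHom (algebraMap ↥(closureValuationSubring (w.adicCompletion F)) (geomResidueField w))) ≫ xt := by
    rw [← hgκ, Category.assoc]
    exact (𝓜.localise w).left_geomReductionMap_comp_fst (thickeningLift e (S.M.obj Kc) y)
  have hS := exists_iso_fibre_baseChange_of_comp_eq (pullback.fst (𝓜.localise w).total.hom (specResidueField w)) xt hsqS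
  obtain ⟨eS, -, hnatS⟩ := hS
  haveI : IsCommMonObj ((𝒜R.baseChange (Spec.map (CommRingCat.ofHom (algebraMap ↥(closureValuationSubring (w.adicCompletion F))
      (geomResidueField w))))).X) := isCommMonObj_baseChange _
  let D := 𝔡 (red₀Of S Kc 𝓜 w h𝓨 e y)
  letI := D.grp₀
  haveI := D.aff₀
  haveI := D.hι₀G.1
  haveI : IsClosedImmersion D.ι₀G.left := D.hι₀G.2
  haveI : Mono D.ι₀G := Over.mono_of_mono_left D.ι₀G
  let φS : ((I.univ.baseChange (pullback.fst (𝓜.localise w).total.hom (specResidueField w))).baseChange (red₀Of S Kc 𝓜 w h𝓨 e y).left).X ≅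
      (𝒜R.baseChange (Spec.map (CommRingCat.ofHom (algebraMap ↥(closureValuationSubring (w.adicCompletion F)) (geomResidueField w))))).X :=
    ⟨(eS I.univ).hom.hom.hom.hom, (eS I.univ).inv.hom.hom.hom, congrArg (fun ψ => ψ.hom.hom.hom) (eS I.univ).hom_inv_id,
      congrArg (fun ψ => ψ.hom.hom.hom) (eS I.univ).inv_hom_id⟩
  haveI : IsMonHom φS.hom := inferInstanceAs (IsMonHom (eS I.univ).hom.hom.hom.hom)
  have hφS : ∀ r, φS.hom ≫ (actR.baseChange _).i r =
      ((I.act.baseChange (pullback.fst (𝓜.localise w).total.hom (specResidueField w))).baseChange (red₀Of S Kc 𝓜 w h𝓨 e y).left).i r ≫ φS.hom :=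
    fun r => by
      haveI := I.act.isMonHom_i r
      exact (congrArg (fun ψ => ψ.hom.hom.hom) (hnatS I.univ I.univ (I.act.i r))).symm
  haveI : Mono φS.hom := ⟨fun g h hgh => (Iso.cancel_iso_hom_right g h φS).mp hgh⟩
  haveI : Mono (D.ι₀G ≫ φS.hom) := mono_comp _ _
  have hG' := forall_exists_comp_eq_iff_of_iso (((IsCMField.complexConj F) • w).asIdeal)
    (fun r => ((I.act.baseChange (pullback.fst (𝓜.localise w).total.hom (specResidueField w))).baseChange (red₀Of S Kc 𝓜 w h𝓨 e y).left).i r)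
    (fun r => (actR.baseChange (Spec.map (CommRingCat.ofHom (algebraMap ↥(closureValuationSubring (w.adicCompletion F)) (geomResidueField w))))).i r)
    D.ι₀G φS hφS D.hkerG₀
  have hrk : Module.finrank (geomResidueField w) (Alg D.G₀) = Nat.card (𝓞 F ⧸ ((IsCMField.complexConj F) • w).asIdeal) ^ 2 := by
    rw [I.hfDeg, sq]; exact D.hrkG₀
  -- the count on the `Ω̄`-points of the lift, DOWN → UP (★ (L-q-sub) §3)
  have hcount := IdealTorsion.natCard_stableSubgroups_baseChange_eq_succ_of_forall_iff actR E' hE' P Q hP hQ hQP hPQ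
    (AlgebraicClosure (w.adicCompletion F)) hNΩ (geomResidueField w) hspan (D.ι₀G ≫ φS.hom) hG' hrk
  -- GENERIC SIDE: the fibre at `ℓ_e y` is the generic fibre of the lift, equivariantly
  have hsqK : (thickeningLift e (S.M.obj Kc) y).left ≫ ((𝓜.localise w).genericIso'.inv.left ≫
      pullback.fst (𝓜.localise w).total.hom (specGenericPoint (HeightOneSpectrum.valuationSubringAtPrime F w) F)) =
      Spec.map (CommRingCat.ofHom (algebraMap ↥(closureValuationSubring (w.adicCompletion F)) (AlgebraicClosure (w.adicCompletion F)))) ≫ xt :=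
    ((𝓜.localise w).left_specFractionFieldι_comp_extendPoint_modelPointsEquiv_symm (thickeningLift e (S.M.obj Kc) y)).symm
  have hK := exists_iso_fibre_baseChange_of_comp_eq ((𝓜.localise w).genericIso'.inv.left ≫
      pullback.fst (𝓜.localise w).total.hom (specGenericPoint (HeightOneSpectrum.valuationSubringAtPrime F w) F)) xt hsqK
  obtain ⟨eK, -, hnatK⟩ := hK
  let φK : (schΩOf S Kc 𝓜 w e I.univ y).X ≅
      (𝒜R.baseChange (Spec.map (CommRingCat.ofHom (algebraMap ↥(closureValuationSubring (w.adicCompletion F)) (AlgebraicClosure (w.adicCompletion F)))))).X :=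
    ⟨(eK I.univ).hom.hom.hom.hom, (eK I.univ).inv.hom.hom.hom, congrArg (fun ψ => ψ.hom.hom.hom) (eK I.univ).hom_inv_id,
      congrArg (fun ψ => ψ.hom.hom.hom) (eK I.univ).inv_hom_id⟩
  haveI : IsMonHom φK.hom := inferInstanceAs (IsMonHom (eK I.univ).hom.hom.hom.hom)
  have hφK : ∀ r, φK.hom ≫ (actR.baseChange _).i r = (actΩOf S Kc 𝓜 w e I.univ I.act r y).hom.hom.hom ≫ φK.hom := fun r => by
    haveI := I.act.isMonHom_i r
    exact (congrArg (fun ψ => ψ.hom.hom.hom) (hnatK I.univ I.univ (I.act.i r))).symm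
  -- transport `#LineOf` along the generic iso and read the count on the lift
  rw [natCard_lineOf_eq_of_iso I y 𝒜R actR _ φK hφK,
    natCard_eq_kCount 𝒜R actR ((IsCMField.complexConj F) • w).asIdeal (I.pChar ^ I.fDeg), ← I.hfDeg]
  exact hcount

set_option backward.isDefEq.respectTransparency false in
/-- **`2 ≤ q`** (`q = p^f = #(𝒪_F ⧸ 𝔭_{c•w})`, the spine rows `hfDeg`∕`hpChar`): the residue field of the maximal ideal `𝔭_{c•w}` is a nontrivial finite ring.  The `hq` input of
★ `exists_ne_ne_of_natCard_eq_succ` for L3's `hthree` ∕ L2's `htwo`. [cite: Hirschfeld1998, §3.1 (Thm. 3.1.1)] [cite: Neukirch1999, Ch. I §3 (3.8)–(3.9)] -/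
theorem two_le_pChar_pow_fDeg (I : RGDInputsAt F ι₁ Jstar K₀ S hU7ₛ hJ hJu Fi Kc G 𝓜 w hw h𝓨 θ e) : 2 ≤ I.pChar ^ I.fDeg := by
  haveI : (((IsCMField.complexConj F) • w).asIdeal).IsMaximal := ((IsCMField.complexConj F) • w).isMaximal
  haveI : Finite (𝓞 F ⧸ ((IsCMField.complexConj F) • w).asIdeal) :=
    Nat.finite_of_card_ne_zero (by rw [I.hfDeg]; exact pow_ne_zero _ I.hpChar.1.ne_zero)
  haveI : Nontrivial (𝓞 F ⧸ ((IsCMField.complexConj F) • w).asIdeal) :=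
    Ideal.Quotient.nontrivial_iff.mpr (Ideal.IsMaximal.ne_top inferInstance)
  rw [← I.hfDeg]
  exact Finite.one_lt_card

end LineCount

/-! ## §1 `spGeoOf` — THE SPECIALISATION OF LINES (LA2-p02 (g0), owner) -/

/-! ### §1a the chosen Serre presentation of `𝔭_{c•w}`, the layer `layerR I y := Ker ψ_P` of the lifted family, its `𝒪_F`-action -/

section Presentation

variable {F : Type} [Field F] [NumberField F] [IsCMField F]

/-- A Serre presentation of `𝔭_{c•w}` exists (★ `exists_serrePresentation_of_ideal`, the conjuncts we read). [cite: Neukirch1999, Ch. I §3 (3.8)–(3.9)] -/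
theorem exists_pres (w : HeightOneSpectrum (𝓞 F)) :
    ∃ (m : ℕ) (E : Matrix (Fin m) (Fin m) (𝓞 F)) (_ : E * E = E) (P : Matrix (Fin m) (Fin 1) (𝓞 F)) (Q : Matrix (Fin 1) (Fin m) (𝓞 F)) (N : ℕ),
      N ≠ 0 ∧ E * P = P ∧ Q * E = Q ∧ Q * P = Matrix.scalar (Fin 1) (N : 𝓞 F) ∧ P * Q = Matrix.scalar (Fin m) (N : 𝓞 F) * E ∧
      Ideal.span (Set.range fun k => P k 0) = ((IsCMField.complexConj F) • w).asIdeal := by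
  obtain ⟨m, E, hE, P, Q, N, h1, h2, h3, h4, h5, h6, -, -⟩ :=
    Literature.NumberTheory.NumberFields.SerrePresentation.exists_serrePresentation_of_ideal
      (((IsCMField.complexConj F) • w).asIdeal) ((IsCMField.complexConj F) • w).ne_bot
  exact ⟨m, E, hE, P, Q, N, h1, h2, h3, h4, h5, h6⟩

/-- the size of the CHOSEN presentation. -/
def mOf (w : HeightOneSpectrum (𝓞 F)) : ℕ := (exists_pres w).choose

/-- the idempotent `E` of the CHOSEN presentation (`𝔟 = E·𝒪ᵐ ≅ 𝔭⁻¹`). [cite: Conrad2004GrossZagier, §7 (Thm. 7.5)] -/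
def EOf (w : HeightOneSpectrum (𝓞 F)) : Matrix (Fin (mOf w)) (Fin (mOf w)) (𝓞 F) := (exists_pres w).choose_spec.choose

/-- `E² = E`. -/
theorem EOf_idem (w : HeightOneSpectrum (𝓞 F)) : EOf w * EOf w = EOf w := (exists_pres w).choose_spec.choose_spec.choose

/-- the column `P` of the CHOSEN presentation (its coordinates generate `𝔭_{c•w}`). [cite: Conrad2004GrossZagier, §7 (Thm. 7.5)] -/
def POf (w : HeightOneSpectrum (𝓞 F)) : Matrix (Fin (mOf w)) (Fin 1) (𝓞 F) := (exists_pres w).choose_spec.choose_spec.choose_spec.choose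

/-- the row `Q` of the CHOSEN presentation (quasi-inverse). [cite: Conrad2004GrossZagier, §7 (Thm. 7.5)] -/
def QOf (w : HeightOneSpectrum (𝓞 F)) : Matrix (Fin 1) (Fin (mOf w)) (𝓞 F) :=
  (exists_pres w).choose_spec.choose_spec.choose_spec.choose_spec.choose

/-- the integer `N` of the CHOSEN presentation (`QP = N`). [cite: Conrad2004GrossZagier, §7 (Thm. 7.5)] -/
def NOf (w : HeightOneSpectrum (𝓞 F)) : ℕ := (exists_pres w).choose_spec.choose_spec.choose_spec.choose_spec.choose_spec.choose

/-- the five laws of the CHOSEN presentation: `N ≠ 0`, `EP = P`, `QE = Q`, `QP = N`, `PQ = N·E`, `span P = 𝔭_{c•w}`. [cite: Conrad2004GrossZagier, §7 (Thm. 7.5)] -/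
theorem pres_laws (w : HeightOneSpectrum (𝓞 F)) :
    NOf w ≠ 0 ∧ EOf w * POf w = POf w ∧ QOf w * EOf w = QOf w ∧ QOf w * POf w = Matrix.scalar (Fin 1) (NOf w : 𝓞 F) ∧
      POf w * QOf w = Matrix.scalar (Fin (mOf w)) (NOf w : 𝓞 F) * EOf w ∧
      Ideal.span (Set.range fun k => POf w k 0) = ((IsCMField.complexConj F) • w).asIdeal :=
  (exists_pres w).choose_spec.choose_spec.choose_spec.choose_spec.choose_spec.choose_spec

end Presentation

section Layer

set_option synthInstance.maxHeartbeats 100000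

open Literature.AlgebraicGeometry.GroupSchemes (GroupSchemeKernel.ker GroupSchemeKernel.kerι)

variable {F : Type} [Field F] [NumberField F] [IsCMField F] {ι₁ : F →+* ℂ}
    {Jstar : Matrix (Fin 2) (Fin 2) F}
    {K₀ : C5.OpenCompactSubgroup ↥(finAdelic ↥(maximalRealSubfield F) F (IsCMField.complexConj F) 2 Jstar)}
    {S : RecordSystemGS F Jstar ι₁ K₀} {hU7ₛ : S.HeckeTranslateDefinedOver}
    {hJ : (Jstar.map (IsCMField.complexConj F))ᵀ = Jstar} {hJu : IsUnit Jstar}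
    {Fi : Type} [Field Fi] [Algebra F Fi] {Kc : C5.SmallLevel K₀} {G : Type} [Group G]
    {𝓜 : IntegralModel (𝓞 F) F ((thickening F Fi).obj (S.M.obj Kc))}
    {w : HeightOneSpectrum (𝓞 F)} {hw : (IsCMField.complexConj F) • w ≠ w} {h𝓨 : (𝓜.localise w).IsSmoothProper 1}
    {θ : ActionOver (𝓜.localise w).total.hom ((Fi ≃ₐ[F] Fi) × G)}
    {e : Fi →ₐ[F] AlgebraicClosure (w.adicCompletion F)}

variable (I : RGDInputsAt F ι₁ Jstar K₀ S hU7ₛ hJ hJu Fi Kc G 𝓜 w hw h𝓨 θ e)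

/-- the lifted family is a commutative group scheme (from `I.comm`, ★ `isCommMonObj_baseChange`). [cite: MumfordFogartyKirwan1994, Ch. 6 §1 Cor. 6.5–6.6 (p. 117)] -/
theorem isCommMonObj_famOf (y : AlgPoints (S.M.obj Kc) (AlgebraicClosure (w.adicCompletion F))) : IsCommMonObj (famOf I y).X := by
  haveI : IsCommMonObj I.univ.X := I.comm
  exact isCommMonObj_baseChange _

/-- **the ideal translation `ψ_P : famOf I y ⟶ famOf I y ⊗_𝒪 𝔟`** of the CHOSEN presentation of `𝔭_{c•w}` (explicit instance: `isCommMonObj_famOf I y`).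
[cite: Conrad2004GrossZagier, §7 (Thm. 7.5)] -/
abbrev transR (y : AlgPoints (S.M.obj Kc) (AlgebraicClosure (w.adicCompletion F))) :=
  @serreTranslate _ (famOf I y) (𝓞 F) _ (actFamOf I y) (isCommMonObj_famOf I y) (mOf w) (EOf w) (EOf_idem w) (POf w)

/-- `ψ_P` is a homomorphism (★ `isMonHom_serreTranslate`) — the instance under which ★ `grpObjKer` makes `layerR I y` a group scheme; supply it with
`haveI := isMonHom_transR I y`. [cite: Conrad2004GrossZagier, §7 (Thm. 7.5)] -/
theorem isMonHom_transR (y : AlgPoints (S.M.obj Kc) (AlgebraicClosure (w.adicCompletion F))) : IsMonHom (transR I y) := by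
  haveI := isCommMonObj_famOf I y
  exact isMonHom_serreTranslate (actFamOf I y) (EOf w) (EOf_idem w) (POf w)

/-- **`layerR I y := Ker ψ_P = (univ ×_𝓨 Spec R)[𝔭_{c•w}]`** — the (S-c) `𝔭_{c•w}`-torsion layer of the lifted family over `R = 𝒪_Ω̄` (★ finite flat closed subgroup, kernel-of-`𝔭`
clause on all points, commutes with base change).  Its group structure is ★ `grpObjKer` under `haveI := isMonHom_transR I y`. [cite: Conrad2004GrossZagier, §7 (Thm. 7.5)]
[cite: Tate1997FiniteFlatGroupSchemes, (3.7)] -/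
abbrev layerR (y : AlgPoints (S.M.obj Kc) (AlgebraicClosure (w.adicCompletion F))) : SchemeOver ↥(closureValuationSubring (w.adicCompletion F)) :=
  GroupSchemeKernel.ker (transR I y)

/-- **`ιR I y : layerR I y ↪ famOf I y`** (★ `kerι`: a monomorphic homomorphism, ★ `mono_kerι` ∕ `isMonHom_kerι`). [cite: GortzWedhorn2020, Definition 4.45 (2), p. 117] -/
abbrev ιR (y : AlgPoints (S.M.obj Kc) (AlgebraicClosure (w.adicCompletion F))) : layerR I y ⟶ (famOf I y).X :=
  GroupSchemeKernel.kerι (transR I y)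

/-- `layerR I y` is affine (★ (S-c) `isAffine_ker_left`). [cite: GortzWedhorn2023, Cor. 27.177 (1)] -/
theorem isAffine_layerR_left (y : AlgPoints (S.M.obj Kc) (AlgebraicClosure (w.adicCompletion F))) : IsAffine (layerR I y).left := by
  haveI := isCommMonObj_famOf I y
  exact IdealTorsion.isAffine_ker_left (actFamOf I y) (EOf w) (EOf_idem w) (POf w) (QOf w) (pres_laws w).1 (pres_laws w).2.1 (pres_laws w).2.2.1 (pres_laws w).2.2.2.1 (pres_laws w).2.2.2.2.1

/-- `layerR I y → Spec R` is finite (★ (S-c) `isFinite_ker_hom`). [cite: GortzWedhorn2023, Cor. 27.177 (1)] -/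
theorem isFinite_layerR_hom (y : AlgPoints (S.M.obj Kc) (AlgebraicClosure (w.adicCompletion F))) : IsFinite (layerR I y).hom := by
  haveI := isCommMonObj_famOf I y
  exact IdealTorsion.isFinite_ker_hom (actFamOf I y) (EOf w) (EOf_idem w) (POf w) (QOf w) (pres_laws w).1 (pres_laws w).2.1 (pres_laws w).2.2.1 (pres_laws w).2.2.2.1 (pres_laws w).2.2.2.2.1

/-- `layerR I y → Spec R` is flat (★ (S-c) `flat_ker_hom`). [cite: MumfordFogartyKirwan1994, Ch. 6 §2 Lemma 6.12 (p. 122)] -/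
theorem flat_layerR_hom (y : AlgPoints (S.M.obj Kc) (AlgebraicClosure (w.adicCompletion F))) : Flat (layerR I y).hom := by
  haveI := isCommMonObj_famOf I y
  exact IdealTorsion.flat_ker_hom (actFamOf I y) (EOf w) (EOf_idem w) (POf w) (QOf w) (pres_laws w).1 (pres_laws w).2.1 (pres_laws w).2.2.1 (pres_laws w).2.2.2.1 (pres_laws w).2.2.2.2.1

/-- `Γ(layerR I y)` is a finite `R`-module (★ (GF) `moduleFinite_alg_ker`). [cite: Tate1997FiniteFlatGroupSchemes, (3.7)] -/
theorem moduleFinite_alg_layerR (y : AlgPoints (S.M.obj Kc) (AlgebraicClosure (w.adicCompletion F))) : Module.Finite ↥(closureValuationSubring (w.adicCompletion F)) (Alg (layerR I y)) := by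
  haveI := isCommMonObj_famOf I y
  exact IdealTorsion.moduleFinite_alg_ker (actFamOf I y) (EOf w) (EOf_idem w) (POf w) (QOf w) (pres_laws w).1 (pres_laws w).2.1 (pres_laws w).2.2.1 (pres_laws w).2.2.2.1 (pres_laws w).2.2.2.2.1

/-- `Γ(layerR I y)` is a flat `R`-module (★ (GF) `moduleFlat_alg_ker`). [cite: EGAIV2, §2.8 (Prop. 2.8.5)] -/
theorem moduleFlat_alg_layerR (y : AlgPoints (S.M.obj Kc) (AlgebraicClosure (w.adicCompletion F))) : Module.Flat ↥(closureValuationSubring (w.adicCompletion F)) (Alg (layerR I y)) := by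
  haveI := isCommMonObj_famOf I y
  exact IdealTorsion.moduleFlat_alg_ker (actFamOf I y) (EOf w) (EOf_idem w) (POf w) (QOf w) (pres_laws w).1 (pres_laws w).2.1 (pres_laws w).2.2.1 (pres_laws w).2.2.2.1 (pres_laws w).2.2.2.2.1

/-- `Γ(layerR I y)` is a free `R`-module (★ (GF) `moduleFree_alg_ker`, `R` local). [cite: StacksProject, Tag 00NZ] -/
theorem moduleFree_alg_layerR (y : AlgPoints (S.M.obj Kc) (AlgebraicClosure (w.adicCompletion F))) : Module.Free ↥(closureValuationSubring (w.adicCompletion F)) (Alg (layerR I y)) := by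
  haveI := isCommMonObj_famOf I y
  exact IdealTorsion.moduleFree_alg_ker (actFamOf I y) (EOf w) (EOf_idem w) (POf w) (QOf w) (pres_laws w).1 (pres_laws w).2.1 (pres_laws w).2.2.1 (pres_laws w).2.2.2.1 (pres_laws w).2.2.2.2.1

set_option maxHeartbeats 400000 in
/-- the (S-c-β) action package on `layerR I y` (★ `exists_action`: intertwined along `ιR`, homomorphic). [cite: Conrad2004GrossZagier, §7 (Thm. 7.5)] -/
theorem exists_βR (y : AlgPoints (S.M.obj Kc) (AlgebraicClosure (w.adicCompletion F))) :
    haveI := isMonHom_transR I y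
    ∃ β : 𝓞 F → (layerR I y ⟶ layerR I y), (∀ a, β a ≫ ιR I y = ιR I y ≫ (actFamOf I y).i a) ∧ ∀ a, IsMonHom (β a) := by
  haveI := isCommMonObj_famOf I y
  obtain ⟨β, h1, h2, -⟩ :=
    IdealTorsion.exists_action (actFamOf I y) (EOf w) (EOf_idem w) (POf w) (pres_laws w).2.1 (pres_laws w).2.2.2.2.2
  exact ⟨β, h1, h2⟩

/-- **the `𝒪_F`-action `βR I y` on `layerR I y`**, lifting `ι(a)` along `ιR` (CHOSEN from `exists_βR`). [cite: Conrad2004GrossZagier, §7 (Thm. 7.5)] -/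
def βR (y : AlgPoints (S.M.obj Kc) (AlgebraicClosure (w.adicCompletion F))) : 𝓞 F → (layerR I y ⟶ layerR I y) :=
  (exists_βR I y).choose

/-- `βR a` lies over `ι(a)`: `βR a ≫ ιR = ιR ≫ (actFamOf I y).i a`. [cite: Kottwitz1992, §5, p. 390] -/
theorem βR_comp_ιR (y : AlgPoints (S.M.obj Kc) (AlgebraicClosure (w.adicCompletion F))) (a : 𝓞 F) : βR I y a ≫ ιR I y = ιR I y ≫ (actFamOf I y).i a :=
  (exists_βR I y).choose_spec.1 a

/-- `βR a` is a homomorphism. [cite: Kottwitz1992, §5, p. 390] -/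
theorem isMonHom_βR (y : AlgPoints (S.M.obj Kc) (AlgebraicClosure (w.adicCompletion F))) (a : 𝓞 F) : haveI := isMonHom_transR I y; IsMonHom (βR I y a) :=
  (exists_βR I y).choose_spec.2 a

end Layer


/-! (★ re-home, size lint: PART 2 of 6 ends here at tree line :644; continued in `Theorems/F0P6aLineSpecialisationFibres.lean`.) -/

end Summit.HodgeConjecture.HodgeConjecture.Cruxes.HLiu418.F0P6aLineSpecialisation
end
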